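import Literature.Computability.AlgebraicComplexity.LRWeightCount
import HarnessLib

/-!
# Landsberg–Ressayre, Thm. 2.8 — the equality case: weight lines and adapted bases (LR17 §6)

Topic `Literature/Computability/AlgebraicComplexity`.  Continues `LRWeightCount.lean` (the count
`TorusData.two_pow_sub_one_le_finrank`: a torus datum `D` on `V` with `dim ker Λ = 1`, an
injective member of the pencil and exact lifts of all row permutations has `dim V ≥ 2^m - 1`) by
the analysis of the EQUALITY CASE `dim V = 2^m - 1` (LR17 §6, last paragraph, and the remark
after Thm. 2.8 that Grenet's representation realises the bound): the `2^m - 1` weight spaces that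
the count exhibits — one `E (wt u_T)` with `supp u_T = T` for every non-empty `T ⊆ [m]` — are then
LINES and exhaust `V`; dually the source weight spaces `F (wt u_S)`, `S ≠ [m]` (with `u_∅ = 0`,
`F γ₀ = ker Λ`), are lines exhausting `V`; and in bases adapted to these lines the pencil is
GRADED like Grenet's branching program: `Λ` maps the source line of `S` onto the target line of
`S` (`∅ ≠ S ≠ [m]`) and kills the kernel line `S = ∅`, and `A_{kj}` maps the source line of `S`
into the target line of `S ∪ {k}` if `k ∉ S` and to `0` if `k ∈ S`.

* `exists_eq_span_of_iSupIndep` — independent non-zero subspaces, as many as the dimension, are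
  lines spanned by a basis;
* `TorusData.F_ne_bot_of_E_le_range` — a target weight inside `range Λ` is a source weight;
* `TorusData.exists_weight_lines` — at equality: exponents `u_S` (`supp u_S = S`) and spanning
  vectors of the target lines `E (wt u_T)` (`T ≠ ∅`) and source lines `F (wt u_S)` (`S ≠ [m]`);
* `TorusData.E_eq_bot_of_forall_ne` — no other target weights;
* `TorusData.exists_adapted_bases` — **adapted bases**: `f_S` (`S ≠ [m]`), `g_T` (`T ≠ ∅`),
  linearly independent, with `Λ f_S = g_S` (`∅ ≠ S ≠ [m]`), `Λ f_∅ = 0`,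
  `A_{kj} f_S ∈ ℂ g_{S ∪ {k}}` (`k ∉ S`), `A_{kj} f_S = 0` (`k ∈ S`).

## References

* J. M. Landsberg, N. Ressayre, *Permanent v. determinant: an exponential lower bound assuming
  symmetry and a potential path towards Valiant's conjecture*, Differential Geom. Appl. 55 (2017)
  146–166, arXiv:1508.05788, §6 (proof of Thm. 2.8) and §2.2 (Grenet's graded representation).
-/

noncomputable section

namespace Literature.Computability.AlgebraicComplexity

namespace LRPencil

open Submodule Module.End Finset

/-! ### Independent lines, as many as the dimension -/

section Lines

variable {K : Type*} [Field K] {V : Type*} [AddCommGroup V] [Module K V] [FiniteDimensional K V]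
  {ι : Type*} [Fintype ι]

/-- If `dim V` independent subspaces of `V` are all non-zero, then they are lines, spanned by a
basis of `V` (one non-zero vector in each). [folklore] -/
theorem exists_eq_span_of_iSupIndep {p : ι → Submodule K V} (hp : iSupIndep p)
    (hne : ∀ i, p i ≠ ⊥) (hcard : Fintype.card ι = Module.finrank K V) :
    ∃ v : ι → V, (∀ i, v i ≠ 0) ∧ (∀ i, p i = K ∙ v i) ∧ LinearIndependent K v ∧
      Submodule.span K (Set.range v) = ⊤ := by
  classical
  have hex : ∀ i, ∃ x ∈ p i, x ≠ 0 := fun i => (Submodule.ne_bot_iff _).1 (hne i)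
  choose v hv hv0 using hex
  have hli : LinearIndependent K v := hp.linearIndependent _ hv hv0
  have hspan : Submodule.span K (Set.range v) = ⊤ := hli.span_eq_top_of_card_eq_finrank' hcard
  refine ⟨v, hv0, fun i => le_antisymm (fun x hx => ?_) ?_, hli, hspan⟩
  · have hx' : x ∈ Submodule.span K (Set.range v) := by rw [hspan]; exact Submodule.mem_top
    obtain ⟨c, rfl⟩ := (Submodule.mem_span_range_iff_exists_fun K).1 hx'
    have hsplit : ∑ j, c j • v j = c i • v i + ∑ j ∈ univ.erase i, c j • v j :=
      (Finset.add_sum_erase _ _ (mem_univ i)).symm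
    have hrest : ∑ j ∈ univ.erase i, c j • v j ∈ ⨆ (j) (_ : j ≠ i), p j := by
      refine Submodule.sum_mem _ fun j hj => Submodule.smul_mem _ _ ?_
      exact (le_iSup₂ (f := fun j (_ : j ≠ i) => p j) j (mem_erase.1 hj).1) (hv j)
    have hrest' : ∑ j ∈ univ.erase i, c j • v j ∈ p i := by
      have e : ∑ j ∈ univ.erase i, c j • v j = (∑ j, c j • v j) - c i • v i := by
        rw [hsplit, add_sub_cancel_left]
      rw [e]
      exact (p i).sub_mem hx ((p i).smul_mem _ (hv i))
    have h0 : ∑ j ∈ univ.erase i, c j • v j = 0 :=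
      (Submodule.mem_bot K).1 ((iSupIndep_def.1 hp i).le_bot ⟨hrest', hrest⟩)
    rw [hsplit, h0, add_zero]
    exact Submodule.mem_span_singleton.2 ⟨c i, rfl⟩
  · rw [Submodule.span_singleton_le_iff_mem]; exact hv i

end Lines

/-! ### Subsets avoiding one subset -/

/-- `|{S ⊆ [m] : S ≠ S₀}| = 2^m - 1`. [folklore] -/
theorem card_subtype_ne_add_one {m : ℕ} (S₀ : Finset (Fin m)) :
    Fintype.card {S : Finset (Fin m) // S ≠ S₀} + 1 = 2 ^ m := by
  rw [Fintype.card_subtype_compl, Fintype.card_subtype_eq, Fintype.card_finset, Fintype.card_fin]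
  have := Nat.one_le_two_pow (n := m)
  omega

namespace TorusData

variable {V : Type*} [AddCommGroup V] [Module ℂ V] [FiniteDimensional ℂ V] {m : ℕ}
  (D : TorusData m V)

/-! ### Source weights from target weights -/

/-- A non-zero target weight space `E β ⊆ range Λ` has a non-zero source weight space `F β`:
a preimage under `Λ` of `0 ≠ v ∈ E β` decomposes along the `C`-weights of the `C`-stable
`Λ⁻¹ (E β)`, and only its `F β`-component survives `Λ` (LR17 §6: `Λ` identifies `ℂⁿ/ℓ_1` with
`ℍ` equivariantly). [cite: LandsbergRessayre2017, §6] -/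
theorem F_ne_bot_of_E_le_range {β : ℂ} (hE : D.E β ≠ ⊥) (hr : D.E β ≤ LinearMap.range D.Λ) :
    D.F β ≠ ⊥ := by
  obtain ⟨v, hv, hv0⟩ := (Submodule.ne_bot_iff _).1 hE
  obtain ⟨w, rfl⟩ := hr hv
  have hw : w ∈ (D.E β).comap D.Λ := hv
  have hle : (D.E β).comap D.Λ ≤ D.F β ⊔ LinearMap.ker D.Λ := by
    refine (D.comap_le_iSup (D.map_E_le β)).trans (iSup_le fun γ => ?_)
    by_cases hγ : γ = β
    · subst hγ
      exact inf_le_right.trans le_sup_left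
    · have h0 : D.E β ⊓ D.E γ = ⊥ :=
        (Module.End.disjoint_genEigenspace D.B (Ne.symm hγ) ⊤ ⊤).eq_bot
      rw [h0, Submodule.comap_bot]
      exact inf_le_left.trans le_sup_right
  obtain ⟨w₁, hw₁, w₀, hw₀, rfl⟩ := Submodule.mem_sup.1 (hle hw)
  intro hF
  rw [hF, Submodule.mem_bot] at hw₁
  apply hv0
  rw [map_add, hw₁, map_zero, zero_add]
  exact LinearMap.mem_ker.1 hw₀

/-! ### The equality case: weight lines -/

/-- **Equality in LR17 Thm. 2.8 — the weight lines.**  For a torus datum with `dim ker Λ = 1`,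
an injective member of the pencil, exact lifts of all row permutations and `dim V = 2^m - 1`
(`m ≥ 1`), there are exponents `u_S` with `supp u_S = S` (`S ⊆ [m]`) such that the target weight
spaces `E (wt u_T)`, `T ≠ ∅`, are LINES `ℂ g_T` whose spanning vectors form a basis of `V`, and the
source weight spaces `F (wt u_S)`, `S ≠ [m]` (`F (wt u_∅) = F γ₀ ⊇ ker Λ`), are lines `ℂ f_S` whose
spanning vectors form a basis of `V` (the `2^m - 1` independent non-zero weight spaces of the count
fill up `V`; on the source side `F (wt u_S) ≠ 0` by `F_ne_bot_of_E_le_range`).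
[cite: LandsbergRessayre2017, §6] -/
theorem exists_weight_lines (hK : Module.finrank ℂ (LinearMap.ker D.Λ) = 1)
    (hgen : ∃ x : Fin m → Fin m → ℂ, Function.Injective (D.Λ + ∑ k, ∑ j, x k j • D.A k j))
    (hperm : ∀ σ : Equiv.Perm (Fin m), Nonempty (Lift D.Λ D.A σ fun _ => (1 : ℂ)))
    (hdim : Module.finrank ℂ V + 1 = 2 ^ m) :
    ∃ (u : Finset (Fin m) → (Fin m → ℕ)) (f : {S : Finset (Fin m) // S ≠ univ} → V)
      (g : {T : Finset (Fin m) // T ≠ ∅} → V),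
      (∀ S, supp (u S) = S) ∧
      (∀ S, f S ≠ 0) ∧ (∀ S : {S : Finset (Fin m) // S ≠ univ}, D.F (D.wt (u S)) = ℂ ∙ f S) ∧
      LinearIndependent ℂ f ∧ Submodule.span ℂ (Set.range f) = ⊤ ∧
      (∀ T, g T ≠ 0) ∧ (∀ T : {T : Finset (Fin m) // T ≠ ∅}, D.E (D.wt (u T)) = ℂ ∙ g T) ∧
      LinearIndependent ℂ g ∧ Submodule.span ℂ (Set.range g) = ⊤ := by
  classical
  have hK0 : LinearMap.ker D.Λ ≠ ⊥ := by
    intro h; rw [h, finrank_bot] at hK; exact zero_ne_one hK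
  have hesc := not_canon_univ_le_range (A := D.A) hK0 hgen
  obtain ⟨βt, hβt⟩ := D.exists_top hK
  obtain ⟨ut, hut, hutne⟩ := D.exists_wt_of_not_le_range hesc
  have hwt : D.wt ut = βt := D.wt_eq_of_not_le_range hβt hutne
  have hgood : D.Good ut := ⟨hut, fun h => hutne (by rw [h]; exact bot_le)⟩
  have hsupp : supp ut = univ := D.supp_eq_univ_of_escape hβt hwt hut.1 hesc hperm
  -- one exponent of support `S` for every `S`, with a non-zero target weight space if `S ≠ ∅`
  have hfull : ∀ S : Finset (Fin m), ∃ u : Fin m → ℕ, supp u = S ∧ (S ≠ ∅ → D.E (D.wt u) ≠ ⊥) := by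
    intro S
    by_cases hS : S = ∅
    · exact ⟨0, by rw [hS]; exact (supp_eq_empty_iff 0).2 rfl, fun h => (h hS).elim⟩
    · obtain ⟨u, -, hsu, hne⟩ := D.full_of_ne_empty hgood hsupp hperm hS
      exact ⟨u, hsu, fun _ h => hne (by rw [eq_bot_iff, ← h]; exact inf_le_right)⟩
  choose u hsu hEu using hfull
  have hinj : ∀ S S', D.wt (u S) = D.wt (u S') → S = S' := fun S S' h => by
    rw [← hsu S, ← hsu S', D.wt_injective h]
  -- target side
  have hcardT : Fintype.card {T : Finset (Fin m) // T ≠ ∅} = Module.finrank ℂ V := by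
    have := card_subtype_ne_add_one (m := m) ∅; omega
  have hindT : iSupIndep fun T : {T : Finset (Fin m) // T ≠ ∅} => D.E (D.wt (u T)) :=
    D.B.independent_maxGenEigenspace.comp (f := fun T : {T : Finset (Fin m) // T ≠ ∅} => D.wt (u T))
      fun T T' h => Subtype.ext (hinj _ _ h)
  obtain ⟨g, hg0, hgE, hgli, hgspan⟩ :=
    exists_eq_span_of_iSupIndep hindT (fun T => hEu T T.2) hcardT
  -- source side
  have hcardS : Fintype.card {S : Finset (Fin m) // S ≠ univ} = Module.finrank ℂ V := by
    have := card_subtype_ne_add_one (m := m) univ; omega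
  have hindS : iSupIndep fun S : {S : Finset (Fin m) // S ≠ univ} => D.F (D.wt (u S)) :=
    D.C.independent_maxGenEigenspace.comp (f := fun S : {S : Finset (Fin m) // S ≠ univ} => D.wt (u S))
      fun S S' h => Subtype.ext (hinj _ _ h)
  have hneS : ∀ S : {S : Finset (Fin m) // S ≠ univ}, D.F (D.wt (u S)) ≠ ⊥ := by
    intro S
    by_cases hS : (S : Finset (Fin m)) = ∅
    · have h0 : u S = 0 := (supp_eq_empty_iff _).1 (by rw [hsu, hS])
      rw [h0, wt_zero]
      exact fun h => hK0 (eq_bot_iff.2 (D.ker_le.trans h.le))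
    · refine D.F_ne_bot_of_E_le_range (hEu S hS) (hβt _ fun h => S.2 ?_)
      rw [← hsu S, D.wt_injective (h.trans hwt.symm), hsupp]
  obtain ⟨f, hf0, hfF, hfli, hfspan⟩ := exists_eq_span_of_iSupIndep hindS hneS hcardS
  exact ⟨u, f, g, hsu, hf0, hfF, hfli, hfspan, hg0, hgE, hgli, hgspan⟩

omit [FiniteDimensional ℂ V] in
/-- At equality there are no other target weights: if the lines `E (w i) = ℂ g_i` span `V`, every
weight space `E β` with `β ∉ {w i}` is zero. [cite: LandsbergRessayre2017, §6] -/
theorem E_eq_bot_of_forall_ne {ι : Type*} {w : ι → ℂ} {g : ι → V}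
    (hgE : ∀ i, D.E (w i) = ℂ ∙ g i) (hspan : Submodule.span ℂ (Set.range g) = ⊤) {β : ℂ}
    (hβ : ∀ i, w i ≠ β) : D.E β = ⊥ := by
  have htop : (⨆ i, D.E (w i)) = ⊤ := by
    rw [eq_top_iff, ← hspan, Submodule.span_le]
    rintro _ ⟨i, rfl⟩
    exact (le_iSup (fun i => D.E (w i)) i) (by rw [hgE]; exact Submodule.mem_span_singleton_self _)
  have h := iSup_maxGen_inf_eq_bot D.B w hβ
  rwa [htop, top_inf_eq] at h

/-! ### The equality case: adapted bases -/

/-- **Equality in LR17 Thm. 2.8 — adapted bases (the pencil is graded like Grenet's branching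
program).**  For a torus datum with `dim ker Λ = 1`, an injective member of the pencil, exact
lifts of all row permutations and `dim V = 2^m - 1` (`m ≥ 1`), there are vectors `f_S`
(`S ⊆ [m]`; the `f_S`, `S ≠ [m]`, linearly independent, hence a basis) and `g_T` (the `g_T`,
`T ≠ ∅`, linearly independent) with `Λ f_S = g_S` for `∅ ≠ S ≠ [m]`, `Λ f_∅ = 0`,
`A_{kj} f_S ∈ ℂ · g_{S ∪ {k}}` for `k ∉ S`, and `A_{kj} f_S = 0` for `k ∈ S`: in these bases `Λ` is
the partial identity and `A_{kj}` is supported on the arcs `S → S ∪ {k}` of the subset lattice, as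
for Grenet's representation (LR17 §2.2). [cite: LandsbergRessayre2017, §6] -/
theorem exists_adapted_bases (hm : 1 ≤ m) (hK : Module.finrank ℂ (LinearMap.ker D.Λ) = 1)
    (hgen : ∃ x : Fin m → Fin m → ℂ, Function.Injective (D.Λ + ∑ k, ∑ j, x k j • D.A k j))
    (hperm : ∀ σ : Equiv.Perm (Fin m), Nonempty (Lift D.Λ D.A σ fun _ => (1 : ℂ)))
    (hdim : Module.finrank ℂ V + 1 = 2 ^ m) :
    ∃ f g : Finset (Fin m) → V,
      LinearIndependent ℂ (fun S : {S : Finset (Fin m) // S ≠ univ} => f S) ∧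
      LinearIndependent ℂ (fun T : {T : Finset (Fin m) // T ≠ ∅} => g T) ∧
      (∀ S, S ≠ ∅ → S ≠ univ → D.Λ (f S) = g S) ∧ D.Λ (f ∅) = 0 ∧
      (∀ (S : Finset (Fin m)) (k j : Fin m), k ∉ S → ∃ t : ℂ, D.A k j (f S) = t • g (insert k S)) ∧
      (∀ (S : Finset (Fin m)) (k j : Fin m), k ∈ S → D.A k j (f S) = 0) := by
  classical
  obtain ⟨u, f, g, hsu, hf0, hfF, hfli, -, hg0, hgE, -, hgspan⟩ :=
    D.exists_weight_lines hK hgen hperm hdim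
  have huniv : (univ : Finset (Fin m)) ≠ ∅ :=
    Finset.nonempty_iff_ne_empty.1 (Finset.univ_nonempty_iff.2 ⟨⟨0, hm⟩⟩)
  have hinj : ∀ S S', D.wt (u S) = D.wt (u S') → S = S' := fun S S' h => by
    rw [← hsu S, ← hsu S', D.wt_injective h]
  have hEbot : ∀ β, (∀ T : {T : Finset (Fin m) // T ≠ ∅}, D.wt (u T) ≠ β) → D.E β = ⊥ :=
    fun β hβ => D.E_eq_bot_of_forall_ne hgE hgspan hβ
  have hindT : iSupIndep fun T : {T : Finset (Fin m) // T ≠ ∅} => D.E (D.wt (u T)) :=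
    D.B.independent_maxGenEigenspace.comp (f := fun T : {T : Finset (Fin m) // T ≠ ∅} => D.wt (u T))
      fun T T' h => Subtype.ext (hinj _ _ h)
  -- the bases: `f'` extends `f` by `0`, `g'` is `Λ f` on the proper non-empty subsets
  let f' : Finset (Fin m) → V := fun S => if h : S = univ then 0 else f ⟨S, h⟩
  let g' : Finset (Fin m) → V := fun T =>
    if h : T = univ then g ⟨univ, huniv⟩ else if h' : T = ∅ then 0 else D.Λ (f ⟨T, h⟩)
  have hf'mem : ∀ S (h : S ≠ univ), f' S ∈ D.F (D.wt (u S)) := fun S h => by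
    simp only [f', dif_neg h]
    rw [hfF ⟨S, h⟩]; exact Submodule.mem_span_singleton_self _
  have hg'mem : ∀ T, T ≠ ∅ → g' T ∈ D.E (D.wt (u T)) ∧ g' T ≠ 0 := by
    intro T hT
    by_cases hTu : T = univ
    · subst hTu
      simp only [g', dif_pos rfl]
      exact ⟨by rw [hgE ⟨univ, huniv⟩]; exact Submodule.mem_span_singleton_self _, hg0 _⟩
    · simp only [g', dif_neg hTu, dif_neg hT]
      have hfmem : f ⟨T, hTu⟩ ∈ D.F (D.wt (u T)) := by
        rw [hfF ⟨T, hTu⟩]; exact Submodule.mem_span_singleton_self _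
      refine ⟨D.map_Λ_F_le _ (Submodule.mem_map_of_mem hfmem), fun h0 => hf0 ⟨T, hTu⟩ ?_⟩
      have huT : u T ≠ 0 := fun h => hT (by rw [← hsu T, h]; exact (supp_eq_empty_iff 0).2 rfl)
      have hmem : f ⟨T, hTu⟩ ∈ LinearMap.ker D.Λ ⊓ D.F (D.wt (u T)) := ⟨h0, hfmem⟩
      rwa [D.ker_inf_F_wt_eq_bot huT, Submodule.mem_bot] at hmem
  have hg'E : ∀ T, T ≠ ∅ → D.E (D.wt (u T)) = ℂ ∙ g' T := by
    intro T hT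
    obtain ⟨hmem, hne⟩ := hg'mem T hT
    rw [hgE ⟨T, hT⟩] at hmem ⊢
    obtain ⟨c, hc⟩ := Submodule.mem_span_singleton.1 hmem
    have hc0 : c ≠ 0 := by
      rintro rfl
      rw [zero_smul] at hc
      exact hne hc.symm
    rw [← hc, Submodule.span_singleton_smul_eq (IsUnit.mk0 c hc0)]
  have hA : ∀ (S : Finset (Fin m)) (k j : Fin m), S ≠ univ →
      D.A k j (f' S) ∈ D.E (D.wt (u S + Pi.single k 1)) := fun S k j hS =>
    D.map_A_F_wt_le k j (u S) (Submodule.mem_map_of_mem (hf'mem S hS))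
  refine ⟨f', g', ?_, hindT.linearIndependent _ (fun T => (hg'mem T T.2).1)
    (fun T => (hg'mem T T.2).2), ?_, ?_, ?_, ?_⟩
  · convert hfli using 1
    funext S
    exact dif_neg S.2
  · intro S hS hSu
    simp only [g', f', dif_neg hSu, dif_neg hS]
  · have h0u : (∅ : Finset (Fin m)) ≠ univ := Ne.symm huniv
    have hE0 : D.E (D.wt (u ∅)) = ⊥ := hEbot _ fun T h => T.2 (hinj _ _ h)
    have h := D.map_Λ_F_le _ (Submodule.mem_map_of_mem (hf'mem ∅ h0u))
    rwa [hE0, Submodule.mem_bot] at h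
  · intro S k j hk
    have hSu : S ≠ univ := fun h => hk (h ▸ mem_univ k)
    by_cases hex : ∃ T : {T : Finset (Fin m) // T ≠ ∅}, D.wt (u T) = D.wt (u S + Pi.single k 1)
    · obtain ⟨T, hT⟩ := hex
      have hTS : (T : Finset (Fin m)) = insert k S := by
        rw [← hsu T, D.wt_injective hT, supp_add_single, hsu]
      have h := hA S k j hSu
      rw [← hT, hg'E T T.2, hTS, Submodule.mem_span_singleton] at h
      obtain ⟨t, ht⟩ := h
      exact ⟨t, ht.symm⟩
    · have hne : ∀ T : {T : Finset (Fin m) // T ≠ ∅}, D.wt (u T) ≠ D.wt (u S + Pi.single k 1) :=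
        fun T hT => hex ⟨T, hT⟩
      have h := hA S k j hSu
      rw [hEbot _ hne, Submodule.mem_bot] at h
      exact ⟨0, by rw [h, zero_smul]⟩
  · intro S k j hk
    by_cases hSu : S = univ
    · simp only [f', dif_pos hSu, map_zero]
    have hne : ∀ T : {T : Finset (Fin m) // T ≠ ∅}, D.wt (u T) ≠ D.wt (u S + Pi.single k 1) := by
      intro T hT
      have huT : u T = u S + Pi.single k 1 := D.wt_injective hT
      have hTS : (T : Finset (Fin m)) = S := by
        rw [← hsu T, huT, supp_add_single, hsu, insert_eq_of_mem hk]
      have h := congrFun huT k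
      rw [hTS, Pi.add_apply, Pi.single_eq_same] at h
      omega
    have h := hA S k j hSu
    rwa [hEbot _ hne, Submodule.mem_bot] at h

end TorusData

end LRPencil

end Literature.Computability.AlgebraicComplexity
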